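import Summits.AtomisticToContinuum.Crystallization.Theorems.ChargedEnergyGapCapCount
import Summits.AtomisticToContinuum.Crystallization.Theorems.ChargedEnergyGapTubeGeometry
import HarnessLib

/-!
# Charged energy gap — lens-3 g64, node «BarlowRef» (R3) — part 15 (addendum; imports parts 14 `…CapCount` and 10 `…TubeGeometry`, land after them): CONE FRUSTA — the exact target-side container of the tube regime

Part 10's sharp shadow cone (`norm_perp_mul_dist_le`: the direction `y → z` makes an angle of sine `≤ r/a` with `y → c`, `a = dist y c > r`)
says that the targets `z` of a source `y` whose segment `[y, z]` meets `B̄(c, r)` lie in the CONE of slope `κ = r/√(a² − r²)` about the axis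
`y → c` with vertex `y`.  Part 13 counted them in CYLINDERS (radius = the cone's radius at the far end of each class; ×1.1–1.5 too many).  This
part types the cone itself:

* `orthoCone b c α β κ μ := {x | α ≤ ⟪b 2, x − c⟫ ≤ β ∧ ⟪b 0, x − c⟫² + ⟪b 1, x − c⟫² ≤ (κ⟪b 2, x − c⟫ + μ)²}` (affine radius), `coneVol κ μ α β :=
  π (κ²(β³ − α³)/3 + κμ(β² − α²) + μ²(β − α))` (= `∫_α^β π(κτ + μ)² dτ`, `integral_cone_profile` by the fundamental theorem of calculus);
* ★★ `volume_orthoCone` — `volume (orthoCone b c α β κ μ) = coneVol κ μ α β` for `0 ≤ κ`, `0 ≤ κα + μ`, `α ≤ β` (Fubini over the axial coordinate,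
  disc slices — the pattern of part 14's `volume_capCoord`);
* ★ `mem_orthoCone_of_shadow` — with `b 2 = a⁻¹ • (c − y)`: `p ∈ [y, z]`, `dist p c ≤ r < a` ⟹ `⟪b 0, z − y⟫² + ⟪b 1, z − y⟫² ≤ (κ ⟪b 2, z − y⟫)²`,
  `κ = r/√(a² − r²)` (part 10 `axial_range` + part 13 Parseval), i.e. `z ∈ orthoCone b y α β κ 0` once `α ≤ ⟪b 2, z − y⟫ ≤ β`;
* `near_orthoCone_subset` — the `D`-neighbourhood of `orthoCone b c α β κ μ` lies in `orthoCone b c (α − D) (β + D) κ (μ + (κ + 1) D)`;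
* ★★ `card_mul_le_cone_of_subset_image` — finite `T ⊆ g '' barlowStacking a h s ∩ orthoCone b c α β κ μ` ⟹
  `#T · a(a√3/2)h ≤ coneVol κ (μ + (κ + 1)·9/5) (α − 9/5) (β + 9/5)`.

With parts 13 (cylinders), 14 (cored caps) and 15 (cone frusta) every container of cert64's certified numerator has its exact volume typed.
0 sorry; standard axioms.
-/

noncomputable section

open scoped Classical RealInnerProductSpace ENNReal
open MeasureTheory
open Literature.MathematicalPhysics.StatisticalMechanics Literature.Geometry.DiscreteGeometry
open Summit.AtomisticToContinuum.Crystallization.Theses.PricedLinkCensus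
open Summit.AtomisticToContinuum.Crystallization.Theorems.ChargedEnergyGapNegative

namespace Summit.AtomisticToContinuum.Crystallization.Theorems.ChargedEnergyGapChartDial

section ConeCount

/-- The solid cone frustum about the axis `b 2` through `c`: axial coordinate in `[α, β]`, radial part at most the affine radius `κ·axial + μ`. -/
def orthoCone (b : OrthonormalBasis (Fin 3) ℝ E3) (c : E3) (α β κ μ : ℝ) : Set E3 :=
  {x | α ≤ ⟪b 2, x - c⟫ ∧ ⟪b 2, x - c⟫ ≤ β ∧ ⟪b 0, x - c⟫ ^ 2 + ⟪b 1, x - c⟫ ^ 2 ≤ (κ * ⟪b 2, x - c⟫ + μ) ^ 2}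

/-- Membership in the cone frustum (definitional). -/
theorem mem_orthoCone_iff (b : OrthonormalBasis (Fin 3) ℝ E3) (c : E3) (α β κ μ : ℝ) (x : E3) :
    x ∈ orthoCone b c α β κ μ ↔
      α ≤ ⟪b 2, x - c⟫ ∧ ⟪b 2, x - c⟫ ≤ β ∧ ⟪b 0, x - c⟫ ^ 2 + ⟪b 1, x - c⟫ ^ 2 ≤ (κ * ⟪b 2, x - c⟫ + μ) ^ 2 := Iff.rfl

/-- The frustum-volume polynomial `coneVol κ μ α β = π (κ²(β³ − α³)/3 + κμ(β² − α²) + μ²(β − α)) = ∫_α^β π (κτ + μ)² dτ`. -/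
def coneVol (κ μ α β : ℝ) : ℝ :=
  Real.pi * (κ ^ 2 * (β ^ 3 - α ^ 3) / 3 + κ * μ * (β ^ 2 - α ^ 2) + μ ^ 2 * (β - α))

/-- The cone profile integral (fundamental theorem of calculus). -/
theorem integral_cone_profile (κ μ α β : ℝ) : ∫ x in α..β, (κ * x + μ) ^ 2 * Real.pi = coneVol κ μ α β := by
  set F : ℝ → ℝ := fun x => Real.pi * (κ ^ 2 * x ^ 3 / 3 + κ * μ * x ^ 2 + μ ^ 2 * x) with hF
  have hderiv : ∀ x, HasDerivAt F ((κ * x + μ) ^ 2 * Real.pi) x := by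
    intro x
    have h3 : HasDerivAt (fun x : ℝ => x ^ 3) (↑(3 : ℕ) * x ^ (3 - 1)) x := hasDerivAt_pow 3 x
    have h2 : HasDerivAt (fun x : ℝ => x ^ 2) (↑(2 : ℕ) * x ^ (2 - 1)) x := hasDerivAt_pow 2 x
    have h1 : HasDerivAt (fun x : ℝ => x) 1 x := hasDerivAt_id x
    have h : HasDerivAt (fun x : ℝ => Real.pi * (κ ^ 2 * x ^ 3 / 3 + κ * μ * x ^ 2 + μ ^ 2 * x))
        (Real.pi * (κ ^ 2 * (↑(3 : ℕ) * x ^ (3 - 1)) / 3 + κ * μ * (↑(2 : ℕ) * x ^ (2 - 1)) + μ ^ 2 * 1)) x :=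
      (((h3.const_mul (κ ^ 2)).div_const 3).add (h2.const_mul (κ * μ)) |>.add (h1.const_mul (μ ^ 2))).const_mul Real.pi
    refine h.congr_deriv ?_
    push_cast
    ring
  have hint : IntervalIntegrable (fun x => (κ * x + μ) ^ 2 * Real.pi) volume α β := (by fun_prop : Continuous fun x : ℝ => (κ * x + μ) ^ 2 * Real.pi).intervalIntegrable _ _
  rw [intervalIntegral.integral_eq_sub_of_hasDerivAt (fun x _ => hderiv x) hint, hF, coneVol]
  ring

/-- The frustum in product coordinates `(axial, planar)`: `volume {α ≤ τ ≤ β, p 0² + p 1² ≤ (κτ + μ)²} = coneVol κ μ α β` (`0 ≤ κ`, `0 ≤ κα + μ`, `α ≤ β`). -/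
theorem volume_coneCoord {κ μ α β : ℝ} (hκ : 0 ≤ κ) (hαμ : 0 ≤ κ * α + μ) (hαβ : α ≤ β) :
    volume {z : ℝ × (Fin 2 → ℝ) | α ≤ z.1 ∧ z.1 ≤ β ∧ z.2 0 ^ 2 + z.2 1 ^ 2 ≤ (κ * z.1 + μ) ^ 2} = ENNReal.ofReal (coneVol κ μ α β) := by
  set S := {z : ℝ × (Fin 2 → ℝ) | α ≤ z.1 ∧ z.1 ≤ β ∧ z.2 0 ^ 2 + z.2 1 ^ 2 ≤ (κ * z.1 + μ) ^ 2} with hSdef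
  have hSm : MeasurableSet S := by
    have e : S = ({z : ℝ × (Fin 2 → ℝ) | α ≤ z.1} ∩ {z | z.1 ≤ β}) ∩ {z | z.2 0 ^ 2 + z.2 1 ^ 2 ≤ (κ * z.1 + μ) ^ 2} := by
      ext z; simp only [hSdef, Set.mem_setOf_eq, Set.mem_inter_iff, and_assoc]
    rw [e]
    refine ((measurableSet_le measurable_const measurable_fst).inter (measurableSet_le measurable_fst measurable_const)).inter
      (measurableSet_le ?_ ?_)
    · exact (((measurable_pi_apply 0).comp measurable_snd).pow_const 2).add (((measurable_pi_apply 1).comp measurable_snd).pow_const 2)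
    · exact ((measurable_fst.const_mul κ).add_const μ).pow_const 2
  have hslice : ∀ τ : ℝ, volume (Prod.mk τ ⁻¹' S) = (Set.Icc α β).indicator (fun τ => ENNReal.ofReal ((κ * τ + μ) ^ 2 * Real.pi)) τ := by
    intro τ
    by_cases hτ : τ ∈ Set.Icc α β
    · rw [Set.indicator_of_mem hτ]
      have hr : 0 ≤ κ * τ + μ := by nlinarith [hτ.1]
      have e : Prod.mk τ ⁻¹' S = {p : Fin 2 → ℝ | p 0 ^ 2 + p 1 ^ 2 ≤ (κ * τ + μ) ^ 2} := by
        ext p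
        simp only [hSdef, Set.mem_preimage, Set.mem_setOf_eq]
        exact ⟨fun h => h.2.2, fun h => ⟨hτ.1, hτ.2, h⟩⟩
      rw [e, volume_coordDisc hr, ← ENNReal.ofReal_pow hr, ← ENNReal.ofReal_mul (sq_nonneg _)]
    · rw [Set.indicator_of_notMem hτ]
      have e : Prod.mk τ ⁻¹' S = ∅ := by
        ext p
        simp only [hSdef, Set.mem_preimage, Set.mem_setOf_eq, Set.mem_empty_iff_false, iff_false, not_and]
        intro h1 h2
        exact absurd (Set.mem_Icc.2 ⟨h1, h2⟩) hτ
      rw [e, measure_empty]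
  rw [show (volume : Measure (ℝ × (Fin 2 → ℝ))) = (volume : Measure ℝ).prod volume from rfl, Measure.prod_apply hSm]
  simp_rw [hslice]
  have hcont : Continuous fun τ : ℝ => (κ * τ + μ) ^ 2 * Real.pi := by fun_prop
  have hnn : ∀ τ ∈ Set.Icc α β, 0 ≤ (κ * τ + μ) ^ 2 * Real.pi := fun τ _ => mul_nonneg (sq_nonneg _) Real.pi_pos.le
  rw [lintegral_indicator measurableSet_Icc,
    ← ofReal_integral_eq_lintegral_ofReal hcont.integrableOn_Icc (ae_restrict_of_forall_mem measurableSet_Icc hnn),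
    integral_Icc_eq_integral_Ioc, ← intervalIntegral.integral_of_le hαβ, integral_cone_profile]

/-- ★★ THE EXACT FRUSTUM VOLUME: `volume (orthoCone b c α β κ μ) = coneVol κ μ α β` for `0 ≤ κ`, `0 ≤ κα + μ`, `α ≤ β`. -/
theorem volume_orthoCone (b : OrthonormalBasis (Fin 3) ℝ E3) (c : E3) {α β κ μ : ℝ} (hκ : 0 ≤ κ) (hαμ : 0 ≤ κ * α + μ) (hαβ : α ≤ β) :
    volume (orthoCone b c α β κ μ) = ENNReal.ofReal (coneVol κ μ α β) := by
  have hT : MeasurePreserving (fun x : E3 => b.repr (x - c)) volume volume :=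
    b.measurePreserving_repr.comp (measurePreserving_sub_right volume c)
  set S := {z : ℝ × (Fin 2 → ℝ) | α ≤ z.1 ∧ z.1 ≤ β ∧ z.2 0 ^ 2 + z.2 1 ^ 2 ≤ (κ * z.1 + μ) ^ 2} with hSdef
  set S' : Set (Fin 3 → ℝ) := {f | α ≤ f 2 ∧ f 2 ≤ β ∧ f 0 ^ 2 + f 1 ^ 2 ≤ (κ * f 2 + μ) ^ 2} with hS'
  have hsplit : S' = (MeasurableEquiv.piFinSuccAbove (fun _ => ℝ) 2) ⁻¹' S := by
    ext f
    simp only [hS', hSdef, Set.mem_setOf_eq, Set.mem_preimage]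
    have e0 : (2 : Fin 3).succAbove 0 = 0 := by decide
    have e1 : (2 : Fin 3).succAbove 1 = 1 := by decide
    show _ ↔ α ≤ f 2 ∧ f 2 ≤ β ∧ f ((2 : Fin 3).succAbove 0) ^ 2 + f ((2 : Fin 3).succAbove 1) ^ 2 ≤ (κ * f 2 + μ) ^ 2
    rw [e0, e1]
  have hSm : MeasurableSet S := by
    have e : S = ({z : ℝ × (Fin 2 → ℝ) | α ≤ z.1} ∩ {z | z.1 ≤ β}) ∩ {z | z.2 0 ^ 2 + z.2 1 ^ 2 ≤ (κ * z.1 + μ) ^ 2} := by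
      ext z; simp only [hSdef, Set.mem_setOf_eq, Set.mem_inter_iff, and_assoc]
    rw [e]
    refine ((measurableSet_le measurable_const measurable_fst).inter (measurableSet_le measurable_fst measurable_const)).inter
      (measurableSet_le ?_ ?_)
    · exact (((measurable_pi_apply 0).comp measurable_snd).pow_const 2).add (((measurable_pi_apply 1).comp measurable_snd).pow_const 2)
    · exact ((measurable_fst.const_mul κ).add_const μ).pow_const 2
  have hS'm : MeasurableSet S' := by rw [hsplit]; exact hSm.preimage (MeasurableEquiv.measurable _)
  have hS'vol : volume S' = ENNReal.ofReal (coneVol κ μ α β) := by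
    rw [hsplit, (volume_preserving_piFinSuccAbove (fun _ : Fin 3 => ℝ) 2).measure_preimage hSm.nullMeasurableSet, volume_coneCoord hκ hαμ hαβ]
  have hset : orthoCone b c α β κ μ = (fun x : E3 => b.repr (x - c)) ⁻¹' ((WithLp.ofLp : E3 → (Fin 3 → ℝ)) ⁻¹' S') := by
    ext x
    simp only [orthoCone, hS', Set.mem_setOf_eq, Set.mem_preimage, b.repr_apply_apply]
  have hmeas : MeasurableSet ((WithLp.ofLp : E3 → (Fin 3 → ℝ)) ⁻¹' S') := hS'm.preimage (PiLp.volume_preserving_ofLp (Fin 3)).measurable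
  rw [hset, hT.measure_preimage hmeas.nullMeasurableSet, (PiLp.volume_preserving_ofLp (Fin 3)).measure_preimage hS'm.nullMeasurableSet, hS'vol]

/-- ★ THE SHADOW CONE IN COORDINATES: source `y`, member `c`, `a = dist y c > r`, axis basis `b 2 = a⁻¹ • (c − y)`; if `p ∈ [y, z]` with
`dist p c ≤ r` then the radial part of `z − y` is at most `κ` times its axial part, `κ = r/√(a² − r²)`:
`⟪b 0, z − y⟫² + ⟪b 1, z − y⟫² ≤ (κ ⟪b 2, z − y⟫)²`, and the axial part is `≥ √(a² − r²)·dist y z ≥ 0`. -/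
theorem radial_sq_le_of_shadow {b : OrthonormalBasis (Fin 3) ℝ E3} {c y z p : E3} {r : ℝ} (hb : b 2 = (dist y c)⁻¹ • (c - y))
    (hp : p ∈ segment ℝ y z) (hpc : dist p c ≤ r) (hry : r < dist y c) :
    ⟪b 0, z - y⟫ ^ 2 + ⟪b 1, z - y⟫ ^ 2 ≤ (r / Real.sqrt (dist y c ^ 2 - r ^ 2) * ⟪b 2, z - y⟫) ^ 2 ∧
      Real.sqrt (dist y c ^ 2 - r ^ 2) * dist y z ≤ dist y c * ⟪b 2, z - y⟫ := by
  have hr : 0 ≤ r := dist_nonneg.trans hpc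
  have ha : 0 < dist y c := hr.trans_lt hry
  have hgap : 0 < dist y c ^ 2 - r ^ 2 := by nlinarith [pow_lt_pow_left₀ hry hr two_ne_zero]
  have hsq : 0 < Real.sqrt (dist y c ^ 2 - r ^ 2) := Real.sqrt_pos.2 hgap
  have hs2 : Real.sqrt (dist y c ^ 2 - r ^ 2) ^ 2 = dist y c ^ 2 - r ^ 2 := Real.sq_sqrt hgap.le
  have hax : ⟪b 2, z - y⟫ = ⟪z - y, c - y⟫ / dist y c := inner_axis_eq hb (z - y)
  obtain ⟨h1, -, -⟩ := axial_range hp hpc hry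
  have hu : dist y c * ⟪b 2, z - y⟫ = ⟪z - y, c - y⟫ := by rw [hax]; field_simp
  have hul : Real.sqrt (dist y c ^ 2 - r ^ 2) * dist y z ≤ dist y c * ⟪b 2, z - y⟫ := by rw [hu]; exact h1
  refine ⟨?_, hul⟩
  have hpar := inner_sq_add_inner_sq_eq b (z - y)
  have hnorm : ‖z - y‖ = dist y z := by rw [dist_eq_norm, norm_sub_rev]
  rw [hnorm] at hpar
  -- dist y z ≤ a·u/√(a² − r²), squared and cleared: d²(a² − r²) ≤ a²u²
  have hdz : dist y z ≤ dist y c * ⟪b 2, z - y⟫ / Real.sqrt (dist y c ^ 2 - r ^ 2) := by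
    rw [le_div_iff₀ hsq, mul_comm]; exact hul
  have hdz2 : dist y z ^ 2 ≤ (dist y c * ⟪b 2, z - y⟫ / Real.sqrt (dist y c ^ 2 - r ^ 2)) ^ 2 := pow_le_pow_left₀ dist_nonneg hdz 2
  rw [div_pow, mul_pow, hs2, le_div_iff₀ hgap] at hdz2
  rw [hpar, show (r / Real.sqrt (dist y c ^ 2 - r ^ 2) * ⟪b 2, z - y⟫) ^ 2 = r ^ 2 * ⟪b 2, z - y⟫ ^ 2 / (dist y c ^ 2 - r ^ 2) by
    rw [mul_pow, div_pow, hs2]; ring, le_div_iff₀ hgap]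
  nlinarith [hdz2]

/-- The `D`-neighbourhood of a cone frustum lies in the frustum widened by `D` axially and by `(κ + 1) D` radially (`0 ≤ κ`, `0 ≤ κα + μ`, `0 ≤ D`). -/
theorem near_orthoCone_subset (b : OrthonormalBasis (Fin 3) ℝ E3) (c : E3) {α β κ μ D : ℝ} (hκ : 0 ≤ κ) (hαμ : 0 ≤ κ * α + μ) (hD : 0 ≤ D) :
    {x : E3 | ∃ z ∈ orthoCone b c α β κ μ, dist x z ≤ D} ⊆ orthoCone b c (α - D) (β + D) κ (μ + (κ + 1) * D) := by
  rintro x ⟨z, hz, hxz⟩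
  rw [mem_orthoCone_iff] at hz ⊢
  obtain ⟨h1, h2, h3⟩ := hz
  have hsplit : x - c = (z - c) + (x - z) := by abel
  have hn2 : ‖b 2‖ = 1 := b.orthonormal.1 2
  have hax : |⟪b 2, x - z⟫| ≤ D := by
    calc |⟪b 2, x - z⟫| ≤ ‖b 2‖ * ‖x - z‖ := abs_real_inner_le_norm _ _
      _ = dist x z := by rw [hn2, one_mul, dist_eq_norm]
      _ ≤ D := hxz
  have hax' := abs_le.1 hax
  have hrz : 0 ≤ κ * ⟪b 2, z - c⟫ + μ := by nlinarith
  have hradz : Real.sqrt (⟪b 0, z - c⟫ ^ 2 + ⟪b 1, z - c⟫ ^ 2) ≤ κ * ⟪b 2, z - c⟫ + μ := by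
    rw [Real.sqrt_le_left hrz]; exact h3
  have hux : ⟪b 2, x - c⟫ = ⟪b 2, z - c⟫ + ⟪b 2, x - z⟫ := by rw [hsplit, inner_add_right]
  have hrad : Real.sqrt (⟪b 0, x - c⟫ ^ 2 + ⟪b 1, x - c⟫ ^ 2) ≤ κ * ⟪b 2, x - c⟫ + (μ + (κ + 1) * D) := by
    rw [hsplit]
    calc Real.sqrt (⟪b 0, z - c + (x - z)⟫ ^ 2 + ⟪b 1, z - c + (x - z)⟫ ^ 2)
        ≤ Real.sqrt (⟪b 0, z - c⟫ ^ 2 + ⟪b 1, z - c⟫ ^ 2) + ‖x - z‖ := radial_add_le b _ _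
      _ ≤ (κ * ⟪b 2, z - c⟫ + μ) + D := add_le_add hradz (by rwa [← dist_eq_norm])
      _ ≤ κ * ⟪b 2, z - c + (x - z)⟫ + (μ + (κ + 1) * D) := by
          rw [inner_add_right]
          nlinarith [hax'.1, hκ]
  have hrx : 0 ≤ κ * ⟪b 2, x - c⟫ + (μ + (κ + 1) * D) := by rw [hux]; nlinarith [hax'.1]
  refine ⟨by rw [hux]; linarith [hax'.1], by rw [hux]; linarith [hax'.2], ?_⟩
  exact (Real.sqrt_le_left hrx).1 hrad

/-- ★★ RECORD SHAPE — sites of a Barlow image in a cone frustum: window `(a,h)`, `g` isometry, `0 ≤ κ`, `0 ≤ κα + μ`, `α ≤ β`, finite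
`T ⊆ g '' barlowStacking a h s ∩ orthoCone b c α β κ μ` ⟹ `#T · a(a√3/2)h ≤ coneVol κ (μ + (κ + 1)·9/5) (α − 9/5) (β + 9/5)`. -/
theorem card_mul_le_cone_of_subset_image {a h : ℝ} {s : ℤ → ℤ} {g : E3 → E3}
    (ha : 9 / 10 ≤ a ∧ a ≤ 11 / 10) (hh : 0 < h ∧ 27 / 50 * a ^ 2 ≤ h ^ 2 ∧ h ^ 2 ≤ 121 / 150 * a ^ 2) (hg : Isometry g)
    (b : OrthonormalBasis (Fin 3) ℝ E3) (c : E3) {α β κ μ : ℝ} (hκ : 0 ≤ κ) (hαμ : 0 ≤ κ * α + μ) (hαβ : α ≤ β)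
    (T : Finset E3) (hT : ↑T ⊆ g '' barlowStacking a h s ∩ orthoCone b c α β κ μ) :
    (T.card : ℝ) * (a * (a * √3 / 2) * h) ≤ coneVol κ (μ + (κ + 1) * (9 / 5)) (α - 9 / 5) (β + 9 / 5) := by
  have ha0 : 0 ≤ a := by linarith [ha.1]
  have hV0 : 0 ≤ a * (a * √3 / 2) * h := by have := hh.1.le; positivity
  have h1 := card_mul_le_volume_near_of_subset_image ha hh hg _ T hT
  have h2 : volume {x : E3 | ∃ z ∈ orthoCone b c α β κ μ, dist x z ≤ 9 / 5} ≤
      volume (orthoCone b c (α - 9 / 5) (β + 9 / 5) κ (μ + (κ + 1) * (9 / 5))) :=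
    measure_mono (near_orthoCone_subset b c hκ hαμ (by norm_num))
  have h3 := h1.trans h2
  have hαμ' : 0 ≤ κ * (α - 9 / 5) + (μ + (κ + 1) * (9 / 5)) := by nlinarith
  rw [volume_orthoCone b c hκ hαμ' (by linarith), ← ENNReal.ofReal_natCast, ← ENNReal.ofReal_mul (Nat.cast_nonneg _),
    ENNReal.ofReal_le_ofReal_iff] at h3
  · exact h3
  · -- coneVol ≥ 0: it is the volume's real value; derive from the integral of a non-negative function
    rw [← integral_cone_profile]
    exact intervalIntegral.integral_nonneg (by linarith) fun x _ => mul_nonneg (sq_nonneg _) Real.pi_pos.le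

end ConeCount

end Summit.AtomisticToContinuum.Crystallization.Theorems.ChargedEnergyGapChartDial

end
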